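import Summits.HodgeConjecture.HodgeConjecture.Theorems.R90S2ArchOrbitalProductOfWeilForm   -- ★ p864368 FILE 1: `IsArchProductFamily` (the binder this file discharges), `archProjAt`, the S2 vocabulary
import Literature.MeasureTheory.Group.InvariantQuotientPi                                  -- ★ `quotientPiHomeomorph` : `(Π G_w) ⧸ (Π C_w) ≃ₜ Π (G_w ⧸ C_w)`
import Literature.MeasureTheory.Group.InvariantQuotientTransport                           -- ★ `cosetCongrHomeomorph`, `cosetCongr_mk`
import Literature.NumberTheory.Automorphic.UnitaryGroupOrbitalMeasureFamilyOfLocal         -- ★ `OrbitalMeasureFamily.atPoint`, `orbitalIntegral_atPoint`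
import Literature.NumberTheory.Automorphic.ArchLocalRegularOrbitClosed                     -- ★ `locallyCompactSpace_archLocal`, `secondCountableTopology_archLocal`
import HarnessLib

/-!
# R90-TF ∕ S2 «Ch. 12 archimedean block» — `R90S2ArchProductMeasureFamily`: the MEASURE-LEVEL DISCHARGE of ★ `IsArchProductFamily`
# (orbital-product road FILE 2: the coset-product homeomorphism `G_∞ ⧸ C(γ) ≃ₜ ∏_w (U(σ_w H)(ℂ) ⧸ C(γ_w))` and exact Fubini for pure tensors)

Cell `pub/hodgecm-mathlib`, HCML Track R90-TF, section S2 (base `R90-C11`), crux h413 = `stmt-HodgeConjecture-24833`, route of record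
`HCCMUnconditional`; prover seat LH4-p05 (g11) on the chair's ACROSS-LINES VALVE (S2 desk K2E1b-plan (g8) «SECOND PROVER CARD» 2026-09-05T01:50:57Z);
lane `--supports stmt-HodgeConjecture-24833 --as helper` (count-neutral; `--kind definition` for the ONE `def`, the homeomorphism `archQuotPiEquiv`).
Conventions of ★ FILE 1 `R90S2ArchOrbitalProductOfWeilForm`: no socket, no instance, no notation, no `sorry`, default heartbeats.

## WHAT
★ FILE 1 states the all-places orbital product tie `IsArchProductFamily H P m mloc` for PURE TENSORS on `G_∞ = U(H)(L ⊗ ℝ) ≃ ∏_w U(σ_w H)(ℂ)`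
(★ `archPiEquivCM`) as a Fubini-as-hypothesis BINDER at `classOrbitalIntegral` level.  THIS FILE pays it from MEASURE-LEVEL data, exactly (no constant):
* `archPiEquivCM_mem_pi_centralizer_iff` — `C(γ) = e⁻¹(∏_w C(γ_w))`: the centraliser of `γ` in `G_∞` corresponds under `e = archPiEquivCM` to the product of the
  centralisers of its components `γ_w = (e γ)_w` (the compatibility letter of ★ `cosetCongr`).
* `archQuotPiEquiv H γ : G_∞ ⧸ C(γ) ≃ₜ ∏_w (U(σ_w H)(ℂ) ⧸ C(γ_w))` — THE COSET-PRODUCT HOMEOMORPHISM (★ `cosetCongrHomeomorph` along `e`, then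
  ★ `quotientPiHomeomorph`), with `archQuotPiEquiv_mk`, `archQuotPiEquiv_symm_mk` (the plain-`Π` twin of ★ `RestrictedProduct/OrbitalEulerProduct`'s
  `quotientHomeomorph`).
* `descConj_archQuotPiEquiv_symm` — the orbital integrand of a pure tensor `f = ⊗_w φ_w` in product coordinates is the product of the local orbital
  integrands (the plain-`Π` twin of ★ `forall_descConj_mk_eq_prod`).
* `orbitalIntegral_archTensor_eq_prod_of_map_eq_pi` — **EXACT FUBINI AT A BASE POINT**: if the measure `μ` on `G_∞ ⧸ C(γ)` is, in product coordinates,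
  the product measure `Measure.pi μw` of σ-finite measures `μw w` on the `U(σ_w H)(ℂ) ⧸ C(γ_w)`, then `O_γ^μ(⊗ φ_w) = ∏_w O_{γ_w}^{μw w}(φ_w)`
  (Mathlib `integral_fintype_prod_eq_prod` after the change of variables `integral_map_equiv`; no integrability needed).
* `isArchProductFamily_of_map_pi` — **THE DISCHARGE**: for a global orbital-measure family `m` (invariant) and admissible local families `mloc w` (invariant,
  finite on compacta), if at every `P`-point `γ` the global measure read AT `γ` (★ `OrbitalMeasureFamily.atPoint`) is, in product coordinates, the product
  of the local measures read at the components `γ_w`, then `IsArchProductFamily H P m mloc`; `isArchProductFamily_of_map_out_pi` is the same with the global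
  measure read at the chosen representative `out [γ]` (no global invariance needed).

HONEST LABEL: plumbing — exact Fubini for pure tensors over the (finitely many) complex places; it pays NO printed input (the measure-level hypothesis is
what the constructor of the kit families of record must supply: «quotient of a product Haar measure by a product of centraliser Haar measures = product of the
quotients», HEADS-CARD4 §2 R2, not here); HC_CM is proved only modulo the 7 printed citations (2 remaining named inputs: hLiu418 = `stmt-HodgeConjecture-24832`,
h413 = `stmt-HodgeConjecture-24833`) until rung 0 closes.  Count-neutral.

References: [Rogawski1990] §5.4 p. 72 (`Φ(γ, f) = ∏_v Φ(γ_v, f_v)`); [Gelbart1975] (9.13)–(9.14), p. 155 (10.19); [BorelJacquet1979] §4.1; [Folland1995] §2.6.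
-/

set_option autoImplicit false
set_option linter.dupNamespace false  -- the route namespace `Summit.HodgeConjecture.HodgeConjecture.…` repeats a component by design (as ★ FILE 1)

noncomputable section

open MeasureTheory NumberField NumberField.InfinitePlace CompactlySupported
open scoped Matrix MatrixGroups Classical  -- `Classical`: the `Fintype` ∕ `DecidableEq` of the complex places (as ★ FILE 1)
open Literature.NumberTheory.Automorphic Literature.NumberTheory.Automorphic.UnitaryGroup
open Literature.MeasureTheory.Group

namespace Summit.HodgeConjecture.HodgeConjecture.R90.S2

/-! ## §1 The coset-product homeomorphism `G_∞ ⧸ C(γ) ≃ₜ ∏_w (U(σ_w H)(ℂ) ⧸ C(γ_w))` and the pure-tensor orbital integrand -/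

section CosetProduct

variable {L : Type} [Field L] [NumberField L] [IsCMField L] {N : ℕ} (H : Matrix (Fin N) (Fin N) L)

/-- **`C(γ) = e⁻¹(∏_w C(γ_w))`**: an element `g ∈ G_∞` commutes with `γ` iff every component `(e g)_w` commutes with `γ_w = (e γ)_w`
(`e = archPiEquivCM`, an isomorphism onto the product) — the compatibility hypothesis of ★ `cosetCongr` for the pair
`C(γ) ≤ G_∞`, `∏_w C(γ_w) ≤ ∏_w U(σ_w H)(ℂ)`. [folklore] -/
theorem archPiEquivCM_mem_pi_centralizer_iff (γ : ↥(arch (↥(maximalRealSubfield L)) L (IsCMField.complexConj L) N H)) :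
    ∀ g : ↥(arch (↥(maximalRealSubfield L)) L (IsCMField.complexConj L) N H),
      (archPiEquivCM L H (N := N)).toMulEquiv g ∈
          Subgroup.pi Set.univ (fun w : {w : InfinitePlace L // w.IsComplex} =>
            Subgroup.centralizer ({archPiEquivCM L H (N := N) γ w} : Set ↥(archLocal L N H w))) ↔
        g ∈ Subgroup.centralizer ({γ} : Set ↥(arch (↥(maximalRealSubfield L)) L (IsCMField.complexConj L) N H)) := by
  intro g
  simp only [Subgroup.mem_pi, Set.mem_univ, true_imp_iff, Subgroup.mem_centralizer_singleton_iff]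
  constructor
  · intro h
    apply (archPiEquivCM L H (N := N)).injective
    rw [map_mul, map_mul]
    funext w
    exact h w
  · intro h w
    have hw := congrArg (fun x => archPiEquivCM L H (N := N) x w) h
    simp only [map_mul] at hw
    exact hw

/-- **THE COSET-PRODUCT HOMEOMORPHISM** `G_∞ ⧸ C(γ) ≃ₜ ∏_w (U(σ_w H)(ℂ) ⧸ C(γ_w))`, `g C(γ) ↦ ((e g)_w C(γ_w))_w`: ★ `cosetCongrHomeomorph` along
`e = archPiEquivCM` (onto `(∏_w U(σ_w H)(ℂ)) ⧸ ∏_w C(γ_w)`), then ★ `quotientPiHomeomorph` (the plain-`Π` twin of ★ `RestrictedProduct/OrbitalEulerProduct`'s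
`quotientHomeomorph`). [cite: Gelbart1975, p. 155 (10.19)] [cite: BorelJacquet1979, §4.1] -/
def archQuotPiEquiv (γ : ↥(arch (↥(maximalRealSubfield L)) L (IsCMField.complexConj L) N H)) :
    ↥(arch (↥(maximalRealSubfield L)) L (IsCMField.complexConj L) N H) ⧸
        Subgroup.centralizer ({γ} : Set ↥(arch (↥(maximalRealSubfield L)) L (IsCMField.complexConj L) N H)) ≃ₜ
      ∀ w : {w : InfinitePlace L // w.IsComplex},
        ↥(archLocal L N H w) ⧸ Subgroup.centralizer ({archPiEquivCM L H (N := N) γ w} : Set ↥(archLocal L N H w)) :=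
  (cosetCongrHomeomorph (archPiEquivCM L H (N := N)).toMulEquiv
      (Subgroup.centralizer ({γ} : Set ↥(arch (↥(maximalRealSubfield L)) L (IsCMField.complexConj L) N H)))
      (Subgroup.pi Set.univ (fun w : {w : InfinitePlace L // w.IsComplex} =>
        Subgroup.centralizer ({archPiEquivCM L H (N := N) γ w} : Set ↥(archLocal L N H w))))
      (archPiEquivCM_mem_pi_centralizer_iff H γ) (archPiEquivCM L H (N := N)).continuous
      (archPiEquivCM L H (N := N)).symm.continuous).trans
    (quotientPiHomeomorph fun w : {w : InfinitePlace L // w.IsComplex} =>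
      Subgroup.centralizer ({archPiEquivCM L H (N := N) γ w} : Set ↥(archLocal L N H w)))

/-- Read-back on classes: `archQuotPiEquiv γ (g C(γ)) = ((e g)_w C(γ_w))_w` (definitional). [folklore] -/
theorem archQuotPiEquiv_mk (γ g : ↥(arch (↥(maximalRealSubfield L)) L (IsCMField.complexConj L) N H)) :
    archQuotPiEquiv H γ (QuotientGroup.mk g) =
      fun w : {w : InfinitePlace L // w.IsComplex} =>
        (QuotientGroup.mk (archPiEquivCM L H (N := N) g w) :
          ↥(archLocal L N H w) ⧸ Subgroup.centralizer ({archPiEquivCM L H (N := N) γ w} : Set ↥(archLocal L N H w))) :=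
  rfl

/-- Read-back of the inverse: `(archQuotPiEquiv γ)⁻¹ ((a_w C(γ_w))_w) = (e⁻¹ a) C(γ)`. [folklore] -/
theorem archQuotPiEquiv_symm_mk (γ : ↥(arch (↥(maximalRealSubfield L)) L (IsCMField.complexConj L) N H))
    (a : ∀ w : {w : InfinitePlace L // w.IsComplex}, ↥(archLocal L N H w)) :
    (archQuotPiEquiv H γ).symm
        (fun w => (QuotientGroup.mk (a w) :
          ↥(archLocal L N H w) ⧸ Subgroup.centralizer ({archPiEquivCM L H (N := N) γ w} : Set ↥(archLocal L N H w)))) =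
      QuotientGroup.mk ((archPiEquivCM L H (N := N)).symm a) := by
  rw [Homeomorph.symm_apply_eq, archQuotPiEquiv_mk]
  funext w
  rw [ContinuousMulEquiv.apply_symm_apply]

/-- **THE ORBITAL INTEGRAND OF A PURE TENSOR IN PRODUCT COORDINATES**: for `f = ⊗_w φ_w` (read back as `f g = ∏_w φ_w((e g)_w)`) the pull-back of
`y C(γ) ↦ f(y γ y⁻¹)` along `(archQuotPiEquiv γ)⁻¹` is `(z_w)_w ↦ ∏_w φ_w(a_w γ_w a_w⁻¹)` (`z_w = a_w C(γ_w)`) — the product of the local orbital integrands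
(the plain-`Π` twin of ★ `forall_descConj_mk_eq_prod`). [cite: Gelbart1975, p. 155 (10.19)] -/
theorem descConj_archQuotPiEquiv_symm (γ : ↥(arch (↥(maximalRealSubfield L)) L (IsCMField.complexConj L) N H))
    {M : Type*} [CommMonoid M] (f : ↥(arch (↥(maximalRealSubfield L)) L (IsCMField.complexConj L) N H) → M)
    (φ : ∀ w : {w : InfinitePlace L // w.IsComplex}, ↥(archLocal L N H w) → M)
    (hf : ∀ g, f g = ∏ w, φ w (archPiEquivCM L H (N := N) g w))
    (z : ∀ w : {w : InfinitePlace L // w.IsComplex},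
      ↥(archLocal L N H w) ⧸ Subgroup.centralizer ({archPiEquivCM L H (N := N) γ w} : Set ↥(archLocal L N H w))) :
    descConj γ (Subgroup.centralizer ({γ} : Set _)) (centralizer_comm γ) f ((archQuotPiEquiv H γ).symm z) =
      ∏ w, descConj (archPiEquivCM L H (N := N) γ w) (Subgroup.centralizer ({archPiEquivCM L H (N := N) γ w} : Set _))
        (centralizer_comm _) (φ w) (z w) := by
  obtain ⟨a, rfl⟩ : ∃ a : ∀ w : {w : InfinitePlace L // w.IsComplex}, ↥(archLocal L N H w),
      z = fun w => (QuotientGroup.mk (a w) :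
        ↥(archLocal L N H w) ⧸ Subgroup.centralizer ({archPiEquivCM L H (N := N) γ w} : Set ↥(archLocal L N H w))) :=
    ⟨fun w => (z w).out, funext fun w => ((z w).out_eq').symm⟩
  rw [archQuotPiEquiv_symm_mk, descConj_mk, hf]
  refine Finset.prod_congr rfl fun w _ => ?_
  rw [descConj_mk, map_mul, map_mul, map_inv, ContinuousMulEquiv.apply_symm_apply]
  rfl

end CosetProduct

/-! ## §2 Exact Fubini for pure tensors and the discharge of ★ `IsArchProductFamily` -/

section Discharge

variable {L : Type} [Field L] [NumberField L] [IsCMField L] {N : ℕ} (H : Matrix (Fin N) (Fin N) L)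
    [∀ γ : ↥(arch (↥(maximalRealSubfield L)) L (IsCMField.complexConj L) N H),
      MeasurableSpace (↥(arch (↥(maximalRealSubfield L)) L (IsCMField.complexConj L) N H) ⧸ Subgroup.centralizer ({γ} : Set _))]
    [∀ γ : ↥(arch (↥(maximalRealSubfield L)) L (IsCMField.complexConj L) N H),
      BorelSpace (↥(arch (↥(maximalRealSubfield L)) L (IsCMField.complexConj L) N H) ⧸ Subgroup.centralizer ({γ} : Set _))]
    [∀ (w : {w : InfinitePlace L // w.IsComplex}) (γ : ↥(archLocal L N H w)),
      MeasurableSpace (↥(archLocal L N H w) ⧸ Subgroup.centralizer ({γ} : Set ↥(archLocal L N H w)))]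
    [∀ (w : {w : InfinitePlace L // w.IsComplex}) (γ : ↥(archLocal L N H w)),
      BorelSpace (↥(archLocal L N H w) ⧸ Subgroup.centralizer ({γ} : Set ↥(archLocal L N H w)))]

/-- **EXACT FUBINI FOR A PURE TENSOR AT A BASE POINT** `O_γ^μ(⊗_w φ_w) = ∏_w O_{γ_w}^{μ_w}(φ_w)`: if the measure `μ` on `G_∞ ⧸ C(γ)` is, in the product
coordinates `archQuotPiEquiv γ`, the product `Measure.pi μw` of σ-finite measures `μw w` on `U(σ_w H)(ℂ) ⧸ C(γ_w)`, then for every `f` with pure-tensor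
read-back `f g = ∏_w φ_w((e g)_w)` the orbital integral of `f` at `γ` against `μ` is the product of the local orbital integrals of the `φ_w` at the
components `γ_w` against the `μw w` — change of variables along the measurable equivalence, `descConj_archQuotPiEquiv_symm`, and Mathlib
`integral_fintype_prod_eq_prod`; exact (no constant) and with no integrability hypothesis (both sides use the same convention for divergent integrals).
[cite: Rogawski1990, §5.4 p. 72] [cite: Gelbart1975, p. 155 (10.19)] -/
theorem orbitalIntegral_archTensor_eq_prod_of_map_eq_pi (γ : ↥(arch (↥(maximalRealSubfield L)) L (IsCMField.complexConj L) N H))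
    (μ : Measure (↥(arch (↥(maximalRealSubfield L)) L (IsCMField.complexConj L) N H) ⧸ Subgroup.centralizer ({γ} : Set _)))
    (μw : ∀ w : {w : InfinitePlace L // w.IsComplex},
      Measure (↥(archLocal L N H w) ⧸ Subgroup.centralizer ({archPiEquivCM L H (N := N) γ w} : Set ↥(archLocal L N H w))))
    [∀ w, SigmaFinite (μw w)]
    (hμ : μ.map (archQuotPiEquiv H γ) = Measure.pi μw)
    {f : ↥(arch (↥(maximalRealSubfield L)) L (IsCMField.complexConj L) N H) → ℂ} {φ : ∀ w : {w : InfinitePlace L // w.IsComplex}, ↥(archLocal L N H w) → ℂ}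
    (hf : ∀ g, f g = ∏ w, φ w (archPiEquivCM L H (N := N) g w)) :
    orbitalIntegral γ f μ = ∏ w, orbitalIntegral (archPiEquivCM L H (N := N) γ w) (φ w) (μw w) := by
  haveI : ∀ w : {w : InfinitePlace L // w.IsComplex}, SecondCountableTopology ↥(archLocal L N H w) := fun w =>
    secondCountableTopology_archLocal L N H w
  set Ψ := (archQuotPiEquiv H γ).toMeasurableEquiv with hΨ
  have hcoe : (Ψ : _ → _) = archQuotPiEquiv H γ := Homeomorph.toMeasurableEquiv_coe _
  have hμ' : μ = (Measure.pi μw).map Ψ.symm := by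
    rw [← hμ, ← hcoe, MeasurableEquiv.map_symm_map]
  rw [orbitalIntegral_eq_integral_descConj, hμ', integral_map_equiv]
  have hpt : ∀ z, descConj γ (Subgroup.centralizer ({γ} : Set _)) (fun _ hg => Subgroup.mem_centralizer_singleton_iff.1 hg) f (Ψ.symm z) =
      ∏ w, descConj (archPiEquivCM L H (N := N) γ w) (Subgroup.centralizer ({archPiEquivCM L H (N := N) γ w} : Set _))
        (centralizer_comm _) (φ w) (z w) := fun z => by
    rw [Homeomorph.toMeasurableEquiv_symm_coe]
    exact descConj_archQuotPiEquiv_symm H γ f φ hf z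
  simp_rw [hpt]
  rw [integral_fintype_prod_eq_prod]
  rfl

variable {P : ↥(arch (↥(maximalRealSubfield L)) L (IsCMField.complexConj L) N H) → Prop}
    {m : OrbitalMeasureFamily ↥(arch (↥(maximalRealSubfield L)) L (IsCMField.complexConj L) N H)}
    {mloc : ∀ w : {w : InfinitePlace L // w.IsComplex}, OrbitalMeasureFamily ↥(archLocal L N H w)}

/-- **THE MEASURE-LEVEL DISCHARGE OF ★ `IsArchProductFamily`** (HEADS-CARD4 §2 D1′ shape (α), read at base points through ★ `OrbitalMeasureFamily.atPoint`):
let `m` be a global orbital-measure family on `G_∞` with invariant measures and `mloc w` local families on the `U(σ_w H)(ℂ)` with invariant measures finite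
on compacta (admissible).  IF at every `γ` with `P γ` the global measure read at `γ`, `m.atPoint γ` on `G_∞ ⧸ C(γ)`, is — in the product coordinates
`archQuotPiEquiv γ` — the product measure of the local measures read at the components, `Measure.pi (w ↦ (mloc w).atPoint γ_w)`, THEN the class orbital
integral of every pure tensor at `[γ]` is the product of the local class orbital integrals at the `[γ_w]`: `IsArchProductFamily H P m mloc`
(Rogawski §5.4: `Φ(γ, f) = ∏_v Φ(γ_v, f_v)` at the archimedean places; exact — `Measure.pi` of the local measures IS the global one by hypothesis).
[cite: Rogawski1990, §5.4 p. 72] [cite: Gelbart1975, (9.14)] [cite: BorelJacquet1979, §4.1] -/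
theorem isArchProductFamily_of_map_pi
    [∀ c : ConjClasses ↥(arch (↥(maximalRealSubfield L)) L (IsCMField.complexConj L) N H),
      SMulInvariantMeasure ↥(arch (↥(maximalRealSubfield L)) L (IsCMField.complexConj L) N H)
        (↥(arch (↥(maximalRealSubfield L)) L (IsCMField.complexConj L) N H) ⧸ Subgroup.centralizer ({(Quotient.out c : _)} : Set _)) (m c)]
    [∀ (w : {w : InfinitePlace L // w.IsComplex}) (c : ConjClasses ↥(archLocal L N H w)),
      SMulInvariantMeasure ↥(archLocal L N H w) (↥(archLocal L N H w) ⧸ Subgroup.centralizer ({(Quotient.out c : _)} : Set ↥(archLocal L N H w)))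
        (mloc w c)]
    [∀ (w : {w : InfinitePlace L // w.IsComplex}) (c : ConjClasses ↥(archLocal L N H w)), IsFiniteMeasureOnCompacts (mloc w c)]
    (hm : ∀ γ, P γ →
      (m.atPoint γ).map (archQuotPiEquiv H γ) = Measure.pi fun w => (mloc w).atPoint (archPiEquivCM L H (N := N) γ w)) :
    IsArchProductFamily H P m mloc := by
  intro φ γ hγ
  haveI : ∀ w : {w : InfinitePlace L // w.IsComplex}, SecondCountableTopology ↥(archLocal L N H w) := fun w =>
    secondCountableTopology_archLocal L N H w
  haveI : ∀ w : {w : InfinitePlace L // w.IsComplex}, LocallyCompactSpace ↥(archLocal L N H w) := fun w =>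
    locallyCompactSpace_archLocal L N H w
  haveI : ∀ w : {w : InfinitePlace L // w.IsComplex}, SigmaFinite ((mloc w).atPoint (archPiEquivCM L H (N := N) γ w)) := fun w => by
    haveI := (mloc w).isFiniteMeasureOnCompacts_atPoint (archPiEquivCM L H (N := N) γ w)
    haveI := isLocallyFiniteMeasure_of_isFiniteMeasureOnCompacts (μ := (mloc w).atPoint (archPiEquivCM L H (N := N) γ w))
    infer_instance
  rw [← m.orbitalIntegral_atPoint γ,
    orbitalIntegral_archTensor_eq_prod_of_map_eq_pi H γ (m.atPoint γ) _ (hm γ hγ) (φ := φ) (fun g => rfl)]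
  refine Finset.prod_congr rfl fun w _ => ?_
  rw [(mloc w).orbitalIntegral_atPoint]
  rfl

/-- **THE DISCHARGE, READ AT THE CHOSEN REPRESENTATIVES** (no global invariance needed): if at every `γ` with `P γ` the global measure `m [γ]` on
`G_∞ ⧸ C(γ₀)`, `γ₀ = out [γ]`, is in the product coordinates `archQuotPiEquiv γ₀` the product of the local measures read at the components of `γ₀`, then
`IsArchProductFamily H P m mloc` (the local classes `[(γ₀)_w]` and `[γ_w]` agree since `γ₀ ∼ γ` and the projections are homomorphisms).
[cite: Rogawski1990, §5.4 p. 72] [cite: Gelbart1975, (9.14)] -/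
theorem isArchProductFamily_of_map_out_pi
    [∀ (w : {w : InfinitePlace L // w.IsComplex}) (c : ConjClasses ↥(archLocal L N H w)),
      SMulInvariantMeasure ↥(archLocal L N H w) (↥(archLocal L N H w) ⧸ Subgroup.centralizer ({(Quotient.out c : _)} : Set ↥(archLocal L N H w)))
        (mloc w c)]
    [∀ (w : {w : InfinitePlace L // w.IsComplex}) (c : ConjClasses ↥(archLocal L N H w)), IsFiniteMeasureOnCompacts (mloc w c)]
    (hm : ∀ γ, P γ →
      (m (ConjClasses.mk γ)).map (archQuotPiEquiv H (Quotient.out (ConjClasses.mk γ))) =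
        Measure.pi fun w => (mloc w).atPoint (archPiEquivCM L H (N := N) (Quotient.out (ConjClasses.mk γ)) w)) :
    IsArchProductFamily H P m mloc := by
  intro φ γ hγ
  haveI : ∀ w : {w : InfinitePlace L // w.IsComplex}, SecondCountableTopology ↥(archLocal L N H w) := fun w =>
    secondCountableTopology_archLocal L N H w
  haveI : ∀ w : {w : InfinitePlace L // w.IsComplex}, LocallyCompactSpace ↥(archLocal L N H w) := fun w =>
    locallyCompactSpace_archLocal L N H w
  set γ₀ := (Quotient.out (ConjClasses.mk γ) : ↥(arch (↥(maximalRealSubfield L)) L (IsCMField.complexConj L) N H)) with hγ₀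
  haveI : ∀ w : {w : InfinitePlace L // w.IsComplex}, SigmaFinite ((mloc w).atPoint (archPiEquivCM L H (N := N) γ₀ w)) := fun w => by
    haveI := (mloc w).isFiniteMeasureOnCompacts_atPoint (archPiEquivCM L H (N := N) γ₀ w)
    haveI := isLocallyFiniteMeasure_of_isFiniteMeasureOnCompacts (μ := (mloc w).atPoint (archPiEquivCM L H (N := N) γ₀ w))
    infer_instance
  rw [classOrbitalIntegral_eq, orbitalIntegral_archTensor_eq_prod_of_map_eq_pi H γ₀ _ _ (hm γ hγ) (φ := φ) (fun g => rfl)]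
  refine Finset.prod_congr rfl fun w _ => ?_
  rw [(mloc w).orbitalIntegral_atPoint]
  have hcl : ConjClasses.mk γ₀ = ConjClasses.mk γ := Quotient.out_eq _
  exact congrArg (classOrbitalIntegral (mloc w) (φ w)) (congrArg (ConjClasses.map (archProjAt H w)) hcl)

end Discharge

end Summit.HodgeConjecture.HodgeConjecture.R90.S2

end
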